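import Literature.Geometry.Kaehler.ComplexTorusHodgeLieAlgebraCommutativeDimension
import Literature.Geometry.Kaehler.ComplexTorusHodgeLieAlgebraProductsPowers
import HarnessLib

/-!
# Small isotropy algebras, and the Hodge Lie algebras of abelian surfaces:
# `dim 𝔨 ≤ 3 ⟹ 𝔨` abelian `⟹ dim 𝔨 ≤ g`; `𝔨 = ℝJ ⟹ dim 𝔭 ≤ 2`; for `g = 2`, `dim 𝔨 ∈ {1, 2, 4}`,
# `(dim 𝔨, dim 𝔭) ∈ {(1,0), (1,2), (2,0), (2,2), (2,4)} ∪ {4} × {2, 4, 6}` and `dim 𝔥𝔤_ℝ ∈ {1, 2, 3, 4, 6, 8, 10}`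

[cite: MoonenZarhin1999LowDim, §2 (2.1), (2.2) and Prop. (2.4); §1] [cite: FiteEtAl2012, §3.2 Lemma 3.7]
[cite: Mostow1974StrongRigidity, §2.10 (p. 16)] [cite: Imai1976HodgeGroups, §2 (p. 368)]
[cite: BrockerTomDieck1985, IV (3.1) (p. 157)] [cite: Lange2023AbelianVarietiesComplex, §7.3.1 Prop. 7.3.2 (pp. 337–338)]

Layer `Literature/Geometry/Kaehler`, namespace `Literature.Geometry.Kaehler.ComplexTorus`; lane `lit-hodgefound`
(Track 2 foundations library), Layer A, prover seat p17 (generation 20), self-proposed row g20-#1 of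
`run/shared/lean/pub/lit-hodgefound/SKELETON.md`.  Sequel, BY NAME, of p40's `ComplexTorusHodgeGroupLieAlgebraCartan`
(the carriers `𝔥𝔤_ℝ = hodgeGroupLie Φ`, `𝔨 = hodgeIsotropyLie Φ`, `𝔭 = hodgeCartanP Φ`, `[𝔭, 𝔭] ⊆ 𝔨`, the
definiteness of the trace form `IsRiemannForm.trace_mul_self_pos_of_mem_hodgeCartanP` /
`…_neg_of_mem_hodgeIsotropyLie`), of p17's `ComplexTorusHodgeLieAlgebraCommutativeDimension` (g19-#2: commutative
subspaces of `𝔨 ⊆ 𝔲(V, E, J)` have `dim ≤ g`, `IsRiemannForm.finrank_le_of_le_hodgeIsotropyLie_of_forall_comm`;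
`𝔭 = 0 ⟹ dim 𝔥𝔤_ℝ ≤ g`), `ComplexTorusHodgeLieAlgebraSiegelDimension` (g18-#4: `dim 𝔨 ≤ g²`, `dim 𝔭 ≤ g(g+1)`,
`dim 𝔭 = g(g+1) ⟺ Hg(X) = Sp(V, E) ⟹ dim 𝔨 = g²`), `ComplexTorusHodgeLieAlgebraCartanPTrivial`
(g18-#2 + rider: `dim 𝔥𝔤_ℝ = dim 𝔨 + dim 𝔭`, `dim 𝔨 ≥ 1`, `dim 𝔭` even), `ComplexTorusHodgeLieAlgebraHodgeTypes`
(`jMatrix_mul_mem_hodgeCartanP`: `J𝔭 ⊆ 𝔭`), `ComplexTorusHodgeLieAlgebraSymplecticDimension` (g17-#1: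
`Hg(X) = Sp(V, E) ⟺ dim 𝔥𝔤_ℝ = g(2g+1)`), `ComplexTorusHodgeLieAlgebraProductsPowers` (g17-#4: `dim 𝔥𝔤_ℝ(Xᴺ) = dim 𝔥𝔤_ℝ(X)`),
`ComplexTorusEllipticCurveHodgeLieAlgebra` (g17-#2: `dim 𝔥𝔤_ℝ(E_τ) ∈ {1, 3}`), `ComplexTorusZarhinTrick` (`IsRiemannForm.pow`)
and `ComplexTorusEllipticCurve` (`isRiemannForm_ellipticForm`).  THEOREMS ONLY: no definition, no named fact, no instance
attribute (the commutator `LieRing.ofAssociativeRing` is bound by `letI` inside proofs), net debt 0.  Only modules whose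
build is currently available are imported: the two further inputs `dim 𝔨 = g² ⟹ dim 𝔭 ∈ {0, g(g+1)}` (p17 g19-#1,
`ComplexTorusHodgeLieAlgebraUnitaryMaximal`) and `[Y, JY] = -2JY²`, `JY² ≠ 0` (p17 g19-#3,
`ComplexTorusHodgeLieAlgebraOneDimensionalDomain`; re-derived here as a private helper) are consumed in the sequel file,
which sharpens the `g = 2` table to the six pairs `(1,0), (1,2), (2,0), (2,2), (2,4), (4,6)`.

## The mathematics and its sources, quoted

For a polarised complex torus `(X, E)` of dimension `g` let `𝔥𝔤_ℝ = Lie Hg(X)(ℝ) = 𝔨 ⊕ 𝔭` be the Cartan decomposition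
under `Ad J` (`J ∈ 𝔨` central in `𝔨`, `[𝔨, 𝔭] ⊆ 𝔭`, `[𝔭, 𝔭] ⊆ 𝔨`, the trace form negative definite on `𝔨 ⊆ 𝔲(V, E, J)`
and positive definite on `𝔭` [Mostow1974StrongRigidity, §2.10: "For any symmetric matrix `X` and skew-symmetric matrix
`Y` we have `Tr XY = -Tr YX = 0`"]).  Moonen–Zarhin list the Hodge groups of simple abelian varieties of low dimension:
"**g = 1.** There are two cases to distinguish. Type I(1): `X` is an elliptic curve with `End⁰(X) = ℚ`. Then
`Hg(X) = Sp(V, φ) ≅ SL_{2,ℚ}`. Type IV(1,1): `X` is an elliptic curve with CM by an imaginary quadratic field `F`. Then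
`Hg(X) = U_F`." and "**g = 2.** There are four cases. Type I(1): `X` is an abelian surface with `End⁰(X) = ℚ`. Then
`Hg(X) = Sp(V, φ) ≅ Sp_{4,ℚ}`. Type I(2): `End⁰(X) = F` is a real quadratic field. Then there is a unique `F`-symplectic
form `ψ : V × V → F` such that `φ = trace_{F/ℚ} ψ`. The Hodge group is given by `Hg(X) = Res_{F/ℚ} Sp_F(V, ψ)`. Type II(1):
`D = End⁰(X)` is a quaternion algebra over `ℚ`, split at `∞`. […] Then `Hg(X)` is the algebraic group `U_{D^opp}` […].
Type IV(2,1): `End⁰(X) = F` is a quartic CM-field not containing an imaginary quadratic subfield. We have `Hg(X) = U_F`."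
[MoonenZarhin1999LowDim, §2 (2.1), (2.2)]; "(2.4) Proposition. Let `X` be a simple complex abelian variety with
`g = dim(X) ≤ 3`. (1) The Hodge Lie algebra `hg(X)` is of non-compact type […] (2) Suppose `X` is of CM-type. Then `Hg(X)`
is a `g`-dimensional algebraic torus." [ibid., Prop. (2.4)]; and for powers "For `n ≥ 1` we can identify `Hg(Xⁿ)` with
`Hg(X)`, acting diagonally" [ibid., §1].  With the products `E × E'` of elliptic curves (Hodge group `Hg(E) × Hg(E')` or
`Hg(E)`), the real Lie algebras `𝔥𝔤_ℝ` of abelian surfaces are `𝔲(1)`, `𝔲(1)²`, `𝔰𝔩₂(ℝ)`, `𝔲(1) ⊕ 𝔰𝔩₂(ℝ)`,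
`𝔰𝔩₂(ℝ)²`, `𝔰𝔭₄(ℝ)`, of dimensions `1, 2, 3, 4, 6, 10` with `(dim 𝔨, dim 𝔭) = (1,0), (2,0), (1,2), (2,2), (2,4), (4,6)`.
Fité–Kedlaya–Rotger–Sutherland state the same list for the compact forms: "We begin by enumerating the options for the
identity component `G⁰`; this classification is well-known in the context of Mumford-Tate groups. **Lemma 3.7.** If `G`
satisfies the Sato-Tate axioms for `w = 1`, `g = h^{1,0} = h^{0,1} = 2`, then `G⁰` is conjugate to one of `U(1)`, `SU(2)`,
`U(1) × U(1)`, `U(1) × SU(2)`, `SU(2) × SU(2)`, `USp(4)`." [FiteEtAl2012, §3.2 Lemma 3.7] — proved there "by the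
classification of Dynkin diagrams" inside `USp(4)/{±1} ≃ SO(5)`; also [Kedlaya, *Sato–Tate groups of genus 2 curves*,
arXiv:1408.6968, Thm. 3.1: "`SO(2), SU(2), SO(2) × SO(2), SO(2) × SU(2), SU(2) × SU(2), USp(4)` […] the abelian surfaces
`E₁ × E₁, E₂ × E₂, E₁ × E'₁, E₁ × E₂, E₂ × E'₂, A`"].

THIS FILE proves the DIMENSION CONSTRAINTS of that classification for the Hodge Lie algebra of EVERY polarised complex torus
of dimension `2`, WITHOUT the structure theory of semisimple Lie algebras, from three elementary facts about `𝔥𝔤_ℝ = 𝔨 ⊕ 𝔭`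
valid in every dimension `g`:

**(A) `dim 𝔨 ≤ 3 ⟹ 𝔨` is commutative, hence `dim 𝔨 ≤ g`.**  For `X, Y ∈ 𝔨` the commutator `C = [X, Y] ∈ 𝔨` satisfies
`tr(C·J) = tr(X·[Y, J]) = 0`, `tr(C·X) = tr(C·Y) = 0` (invariance of the trace form and `J ∈ Z(𝔨)`).  If `J, X, Y` are
linearly independent they span `𝔨`, so `tr(C²) = 0` and `C = 0` by negativity; otherwise `X, Y` commute outright.  A
commutative `𝔨` is a commutative subalgebra of `𝔲(V, E, J) ≅ 𝔲(g)` and has `dim ≤ g` [BrockerTomDieck1985, IV (3.1)]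
(g19-#2).  So `dim 𝔨 ∉ (g, 3]`: `dim 𝔨 ≠ 3` for `g = 2`.

**(B) `[𝔭, 𝔭] ⊆ ℝJ ⟹ dim 𝔭 ≤ 2`** — in particular **`dim 𝔨 = 1 ⟹ dim 𝔭 ∈ {0, 2}`, `dim 𝔥𝔤_ℝ ∈ {1, 3}`.**  On `𝔭`,
`ad J = 2J·` and `[P, JP] = -2JP² ≠ 0` for `P ≠ 0` (`tr P² > 0`, g19-#3), so `𝔭 ≠ 0 ⟹ [𝔭, 𝔭] ≠ 0`.  If `[P, Q] = ω(P, Q)J` for all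
`P, Q ∈ 𝔭`, the Jacobi identity gives `J(ω(P,Q)R + ω(Q,R)P + ω(R,P)Q) = 0`; with `dim 𝔭 ≥ 3` pick `P ≠ 0`, `Q = JP`,
`R ∉ span{P, JP}` to get `ω(P, JP) = 0`, a contradiction.  When `𝔨 = ℝJ` moreover `P² ∈ ℝ·1` for every `P ∈ 𝔭`
(`2JP² ∈ ℝJ`), as in `𝔥𝔤_ℝ(Eᵍ) = Δ𝔰𝔩₂(ℝ)`.

**(C)** the lane's dimension theory: `1 ≤ dim 𝔨 ≤ g²`, `dim 𝔭 ≤ g(g+1)` even, `dim 𝔭 = g(g+1) ⟺ Hg(X) = Sp(V, E) ⟹ dim 𝔨 = g²`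
(g18-#4), `𝔭 = 0 ⟹ 𝔥𝔤_ℝ = 𝔨` commutative `⟹ dim 𝔥𝔤_ℝ ≤ g` (g18-#2, g19-#2).

For `g = 2`: `dim 𝔨 ∈ {1, 2, 4}` by (A),(C); `dim 𝔭 ∈ {0, 2, 4, 6}`; `dim 𝔨 = 1 ⟹ dim 𝔭 ≤ 2` (B); `dim 𝔭 = 6 ⟹ dim 𝔨 = 4`;
`dim 𝔨 = 4 ⟹ 𝔭 ≠ 0` (else `dim 𝔥𝔤_ℝ = 4 > g`).  Hence `(dim 𝔨, dim 𝔭) ∈ {(1,0), (1,2), (2,0), (2,2), (2,4)} ∪ {4} × {2, 4, 6}` and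
`dim 𝔥𝔤_ℝ ∈ {1, 2, 3, 4, 6, 8, 10}` (the sequel removes `(4,2)`, `(4,4)` and `8` with g19-#1's `dim 𝔨 = g² ⟹ dim 𝔭 ∈ {0, g(g+1)}`),
with `dim 𝔥𝔤_ℝ = 10 ⟺ Hg(X) = Sp(V, E)`, `dim 𝔥𝔤_ℝ ≤ 2 ⟺ 𝔭 = 0` (CM type), `dim 𝔥𝔤_ℝ = 3 ⟺ (dim 𝔨, dim 𝔭) = (1, 2)`,
`dim 𝔥𝔤_ℝ = 4 ⟺ (dim 𝔨, dim 𝔭) = (2, 2)`.  The squares `E_i × E_i` and `E_τ × E_τ` (`τ = i·2^{1/4}`, no CM) realise `(1, 0)`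
and `(1, 2)` (§4).

## What is proved (all statements are theorems; no `sorry`)

§0 (private) trace identities `tr([X,Y]Z) = tr(X[Y,Z])`.  §1 `jMatrix_mul_sub_mul_jMatrix_eq_two_smul` (`[J, Z] = 2JZ` on `𝔭`),
`IsRiemannForm.mul_jMatrix_mul_sub_ne_zero` (`[P, JP] ≠ 0`), **`IsRiemannForm.exists_mul_sub_mul_ne_zero_of_hodgeCartanP_ne_bot`**
(`𝔭 ≠ 0 ⟹ [𝔭, 𝔭] ≠ 0`), `IsRiemannForm.hodgeCartanP_eq_bot_of_forall_comm`.
§2 `trace_sub_mul_jMatrix_eq_zero`, **`IsRiemannForm.comm_of_mem_hodgeIsotropyLie_of_finrank_le_three`** (A),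
**`IsRiemannForm.finrank_hodgeIsotropyLie_le_of_finrank_le_three`** (`dim 𝔨 ≤ 3 ⟹ dim 𝔨 ≤ g`),
`IsRiemannForm.finrank_hodgeIsotropyLie_le_or_four_le`, `IsRiemannForm.four_le_finrank_hodgeIsotropyLie_of_ne`,
**`IsRiemannForm.finrank_hodgeCartanP_le_two_of_forall_sub_mem_span`** (B), `exists_smul_jMatrix_eq_of_finrank_hodgeIsotropyLie_eq_one`
(`dim 𝔨 = 1 ⟹ 𝔨 = ℝJ`), **`IsRiemannForm.finrank_hodgeCartanP_le_two_of_finrank_hodgeIsotropyLie_eq_one`**,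
`IsRiemannForm.finrank_hodgeCartanP_eq_zero_or_eq_two_of_finrank_hodgeIsotropyLie_eq_one`,
**`IsRiemannForm.finrank_hodgeGroupLie_eq_one_or_eq_three_of_finrank_hodgeIsotropyLie_eq_one`**,
`IsRiemannForm.finrank_hodgeGroupLie_le_three_of_finrank_hodgeIsotropyLie_eq_one`,
`exists_mul_self_eq_smul_one_of_finrank_hodgeIsotropyLie_eq_one` / `IsRiemannForm.exists_pos_mul_self_eq_smul_one_of_…` (`P² = β·1`, `β > 0`).
§3 `g = 1`: `IsRiemannForm.finrank_hodgeIsotropyLie_eq_one_of_finrank_eq_one`, `IsRiemannForm.finrank_prod_mem_of_finrank_eq_one`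
(`(dim 𝔨, dim 𝔭) ∈ {(1,0), (1,2)}`), `IsRiemannForm.finrank_hodgeGroupLie_mem_of_finrank_eq_one` (`∈ {1, 3}`);
`g = 2`: `IsRiemannForm.finrank_hodgeIsotropyLie_le_two_or_eq_four_of_finrank_eq_two`,
**`IsRiemannForm.finrank_hodgeIsotropyLie_mem_of_finrank_eq_two`** (`dim 𝔨 ∈ {1, 2, 4}`), `IsRiemannForm.finrank_hodgeIsotropyLie_ne_three_of_finrank_eq_two`,
`IsRiemannForm.finrank_hodgeCartanP_mem_of_finrank_eq_two` (`dim 𝔭 ∈ {0, 2, 4, 6}`),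
`IsRiemannForm.hodgeCartanP_ne_bot_of_finrank_hodgeIsotropyLie_eq_four`, `IsRiemannForm.finrank_hodgeCartanP_eq_six_iff_of_finrank_eq_two`
(`⟺ Hg(X) = Sp(V, E)`), `IsRiemannForm.finrank_hodgeIsotropyLie_eq_four_of_finrank_hodgeCartanP_eq_six`,
**`IsRiemannForm.finrank_prod_mem_of_finrank_eq_two`** (the pair table), **`IsRiemannForm.finrank_hodgeGroupLie_mem_of_finrank_eq_two`**
(`dim 𝔥𝔤_ℝ ∈ {1, 2, 3, 4, 6, 8, 10}`), `IsRiemannForm.finrank_hodgeGroupLie_ne_of_finrank_eq_two` (`∉ {5, 7, 9}`, `≤ 10`),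
`IsRiemannForm.finrank_hodgeGroupLie_eq_ten_iff_of_finrank_eq_two` (`⟺ Hg(X) = Sp(V, E)`),
`IsRiemannForm.finrank_hodgeGroupLie_le_two_iff_of_finrank_eq_two` (`⟺ 𝔭 = 0`),
`IsRiemannForm.finrank_hodgeGroupLie_eq_three_iff_of_finrank_eq_two` (`⟺ (dim 𝔨, dim 𝔭) = (1, 2)`),
`IsRiemannForm.finrank_hodgeGroupLie_eq_four_iff_of_finrank_eq_two` (`⟺ (2, 2)`), and the `IsAbelianVariety.…` forms.
§4 examples: `finrank_prod_pow_two_ellipticPeriod_I` (`E_i²`: `(1, 0)`), `finrank_prod_pow_two_ellipticPeriod_I_mul_sqrt_sqrt_two`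
(`E_τ²`, `τ = i·2^{1/4}`: `(1, 2)`), `finrank_hodgeGroupLie_pow_ellipticPeriod_eq_one_or_eq_three` (`dim 𝔥𝔤_ℝ(E_τᴺ) ∈ {1, 3}`).

NOT here: the exclusion of `(dim 𝔨, dim 𝔭) = (4, 2), (4, 4)` (sequel, via g19-#1); EXISTENCE of abelian surfaces realising `(2,0)`, `(2,2)`, `(2,4)` (the products `E × E'` — the tree has the
Hodge GROUPS of such products, not yet the Lie-algebra dimension count) and `(4,6)` (a Hodge-general surface, Lange
Prop. 7.3.2 "for a general polarized abelian variety"); the isomorphism types `𝔥𝔤_ℝ ≅ 𝔰𝔩₂(ℝ)`, `𝔰𝔩₂(ℝ)²`, … and the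
`ℚ`-forms `Res_{F/ℚ} SL₂`, `U_D`, `U_F` of Moonen–Zarhin's list (only real dimensions are computed); the Sato–Tate groups and
component groups of [FiteEtAl2012] (nothing arithmetic is touched); the converse "`𝔨` commutative `⟹ dim 𝔭 ≤ 2 dim 𝔨`"
(polydisc type) in dimension `g ≥ 3`.

## References

* [MoonenZarhin1999LowDim] B. Moonen, Yu. G. Zarhin, *Hodge classes on abelian varieties of low dimension*, Math. Ann.
  315 (1999) 711–733, §1, §2 (2.1), (2.2), Prop. (2.4) (held copy `paper:arxiv-math_9901113`, chunks p0002, p0005).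
* [FiteEtAl2012] F. Fité, K. S. Kedlaya, V. Rotger, A. V. Sutherland, *Sato–Tate distributions and Galois endomorphism
  modules in genus 2*, Compositio Math. 148 (2012) 1390–1442, §3.2 Lemma 3.7 and §4.2 (held copy `paper:arxiv-1110.6638`,
  chunks p0011, p0014).
* K. S. Kedlaya, *Sato–Tate groups of genus 2 curves*, arXiv:1408.6968 (2014), in: Advances on Superelliptic Curves and
  their Applications (2015), Thm. 3.1 (held copy `paper:arxiv-1408.6968`, chunk p0011).
* [Mostow1974StrongRigidity] G. D. Mostow, *Strong Rigidity of Locally Symmetric Spaces*, Ann. of Math. Stud. 78 (1973),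
  §2.10 (held copy p0016).
* [Imai1976HodgeGroups] H. Imai, *On the Hodge groups of some abelian varieties*, Kodai Math. Sem. Rep. 27 (1976), §2 (p. 368).
* [BrockerTomDieck1985] Th. Bröcker, T. tom Dieck, *Representations of Compact Lie Groups*, GTM 98 (1985), IV (3.1) (p. 157).
* [Lange2023AbelianVarietiesComplex] H. Lange, *Abelian Varieties over the Complex Numbers*, Grundlehren 360 (2023),
  §7.3.1 Prop. 7.3.2 (pp. 337–338).
* [CarlsonMullerStachPeters2017] J. Carlson, S. Müller-Stach, C. Peters, *Period Mappings and Period Domains*, 2nd ed.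
  (2017), §16.3 Remarks 16.3.4 (iii) (p. 393).
* [Wallach2017GIT] N. R. Wallach, *Geometric Invariant Theory over the Real and Complex Numbers* (2017), §2.2.2.1 (p. 49–50).
-/

noncomputable section

open scoped Matrix Real

open Set Function Module Matrix NormedSpace Complex

namespace Literature.Geometry.Kaehler

namespace ComplexTorus

/-! ## §0 Trace identities: `tr([X, Y] Z) = tr(X [Y, Z])` -/

section Trace

variable {ι : Type*} [Fintype ι]

/-- Invariance of the trace form under the commutator: `tr((XY - YX) Z) = tr(X (YZ - ZY))`. [folklore] -/
private theorem trace_sub_mul_eq (X Y Z : Matrix ι ι ℝ) :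
    ((X * Y - Y * X) * Z).trace = (X * (Y * Z - Z * Y)).trace := by
  have h : (Y * X * Z).trace = (X * Z * Y).trace := by
    rw [Matrix.mul_assoc, Matrix.trace_mul_comm]
  rw [Matrix.sub_mul, Matrix.mul_sub, Matrix.trace_sub, Matrix.trace_sub, h]
  simp only [Matrix.mul_assoc]

/-- `tr((XY - YX) Z) = 0` when `Z` commutes with `Y`. [folklore] -/
private theorem trace_sub_mul_eq_zero_of_comm {X Y Z : Matrix ι ι ℝ} (h : Y * Z = Z * Y) :
    ((X * Y - Y * X) * Z).trace = 0 := by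
  rw [trace_sub_mul_eq, h, sub_self, Matrix.mul_zero, Matrix.trace_zero]

/-- `tr((XY - YX) Y) = 0`. [folklore] -/
private theorem trace_sub_mul_right_eq_zero (X Y : Matrix ι ι ℝ) : ((X * Y - Y * X) * Y).trace = 0 :=
  trace_sub_mul_eq_zero_of_comm rfl

/-- `tr((XY - YX) X) = 0`. [folklore] -/
private theorem trace_sub_mul_left_eq_zero (X Y : Matrix ι ι ℝ) : ((X * Y - Y * X) * X).trace = 0 := by
  rw [← neg_sub (Y * X) (X * Y), Matrix.neg_mul, Matrix.trace_neg, trace_sub_mul_right_eq_zero, neg_zero]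

end Trace

/-! ## §1 `[J, Z] = 2JZ` on `𝔭`, and `𝔭 ≠ 0 ⟹ [𝔭, 𝔭] ≠ 0` -/

section CartanP

variable {ι : Type*} [Fintype ι] [DecidableEq ι] {E : Type*} [NormedAddCommGroup E] [NormedSpace ℂ E]
  {Φ : (ι → ℝ) ≃L[ℝ] E} {η : E [⋀^Fin 2]→L[ℝ] ℝ}

/-- **`[J, Z] = 2JZ` for `Z ∈ 𝔭`** (`JZ = -ZJ`): on `𝔭 = T_J D` the involution generator acts by `ad J = 2J·`, a complex
structure up to the factor `2`. [cite: Mostow1974StrongRigidity, §2.10 (p. 16)]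
[cite: CarlsonMullerStachPeters2017, §16.3 Remarks 16.3.4 (iii) (p. 393)] -/
theorem jMatrix_mul_sub_mul_jMatrix_eq_two_smul {Z : Matrix ι ι ℝ} (hZ : Z ∈ hodgeCartanP Φ) :
    jMatrix Φ * Z - Z * jMatrix Φ = (2 : ℝ) • (jMatrix Φ * Z) := by
  rw [show Z * jMatrix Φ = -(jMatrix Φ * Z) by rw [hZ.2, neg_neg], sub_neg_eq_add, two_smul]

/-- `[P, JP] = -2JP²` for `P ∈ 𝔭` — a local copy of g19-#3's `mul_jmul_sub_jmul_mul_of_anticomm`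
(`ComplexTorusHodgeLieAlgebraOneDimensionalDomain`, whose olean is not yet available to importers). [folklore]
[cite: Mostow1974StrongRigidity, §2.10 (p. 16)] -/
private theorem mul_jMatrix_mul_sub_eq_neg_two_smul {P : Matrix ι ι ℝ} (hP : P ∈ hodgeCartanP Φ) :
    P * (jMatrix Φ * P) - jMatrix Φ * P * P = (-2 : ℝ) • (jMatrix Φ * (P * P)) := by
  have h : P * jMatrix Φ = -(jMatrix Φ * P) := by rw [hP.2, neg_neg]
  rw [← Matrix.mul_assoc P (jMatrix Φ) P, h, Matrix.neg_mul, Matrix.mul_assoc, neg_smul, two_smul]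
  abel

/-- **`[P, JP] = -2JP² ≠ 0` for `0 ≠ P ∈ 𝔭`** (polarised torus: `tr(P²) > 0`, so `P² ≠ 0` and `JP² ≠ 0`): the complex
line `ℂ·P ⊆ 𝔭` is never an abelian subalgebra.
[cite: Mostow1974StrongRigidity, §2.10 (p. 16)] [cite: CarlsonMullerStachPeters2017, §16.3 Remarks 16.3.4 (iii) (p. 393)] -/
theorem IsRiemannForm.mul_jMatrix_mul_sub_ne_zero (hη : IsRiemannForm Φ η) {P : Matrix ι ι ℝ}
    (hP : P ∈ hodgeCartanP Φ) (h0 : P ≠ 0) : P * (jMatrix Φ * P) - jMatrix Φ * P * P ≠ 0 := by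
  rw [mul_jMatrix_mul_sub_eq_neg_two_smul hP, smul_ne_zero_iff]
  refine ⟨by norm_num, fun h ↦ ?_⟩
  -- `J P² = 0 ⟹ P² = 0 ⟹ tr(P²) = 0`, contradicting positivity
  have h2 : P * P = 0 := by
    have h3 := congrArg (jMatrix Φ * ·) h
    simp only [jMatrix_mul_jMatrix_mul, Matrix.mul_zero, neg_eq_zero] at h3
    exact h3
  have hpos := hη.trace_mul_self_pos_of_mem_hodgeCartanP hP h0
  rw [h2, Matrix.trace_zero] at hpos
  exact lt_irrefl _ hpos

/-- **`𝔭 ≠ 0 ⟹ [𝔭, 𝔭] ≠ 0`** (polarised torus): a nonzero Cartan subspace contains two non-commuting elements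
(`P` and `JP`). [cite: Mostow1974StrongRigidity, §2.10 (p. 16)] [cite: CarlsonMullerStachPeters2017, §16.3 Remarks 16.3.4 (iii) (p. 393)] -/
theorem IsRiemannForm.exists_mul_sub_mul_ne_zero_of_hodgeCartanP_ne_bot (hη : IsRiemannForm Φ η)
    (h : hodgeCartanP Φ ≠ ⊥) : ∃ P ∈ hodgeCartanP Φ, ∃ Q ∈ hodgeCartanP Φ, P * Q - Q * P ≠ 0 := by
  obtain ⟨P, hP, h0⟩ := (Submodule.ne_bot_iff _).1 h
  exact ⟨P, hP, jMatrix Φ * P, jMatrix_mul_mem_hodgeCartanP Φ hP, hη.mul_jMatrix_mul_sub_ne_zero hP h0⟩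

/-- **A commutative Cartan subspace is zero**: if all elements of `𝔭` commute then `𝔭 = 0` (polarised torus).
[cite: Mostow1974StrongRigidity, §2.10 (p. 16)] [cite: CarlsonMullerStachPeters2017, §16.3 Remarks 16.3.4 (iii) (p. 393)] -/
theorem IsRiemannForm.hodgeCartanP_eq_bot_of_forall_comm (hη : IsRiemannForm Φ η)
    (h : ∀ P ∈ hodgeCartanP Φ, ∀ Q ∈ hodgeCartanP Φ, P * Q = Q * P) : hodgeCartanP Φ = ⊥ := by
  by_contra hne
  obtain ⟨P, hP, Q, hQ, hPQ⟩ := hη.exists_mul_sub_mul_ne_zero_of_hodgeCartanP_ne_bot hne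
  exact hPQ (sub_eq_zero.2 (h P hP Q hQ))

end CartanP

/-! ## §2 Small isotropy algebras: `dim 𝔨 ≤ 3 ⟹ 𝔨` abelian `⟹ dim 𝔨 ≤ g`; `[𝔭, 𝔭] ⊆ ℝJ ⟹ dim 𝔭 ≤ 2` -/

section SmallIsotropy

variable {ι : Type*} [Fintype ι] [DecidableEq ι] {E : Type*} [NormedAddCommGroup E] [NormedSpace ℂ E]
  {Φ : (ι → ℝ) ≃L[ℝ] E} {η : E [⋀^Fin 2]→L[ℝ] ℝ}

/-- For `Y ∈ 𝔨` and any `X`, the commutator `[X, Y]` is trace-orthogonal to `J` (`J` commutes with `Y`).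
[cite: Mostow1974StrongRigidity, §2.10 (p. 16: "`Tr XY = -Tr YX`")] -/
theorem trace_sub_mul_jMatrix_eq_zero {X Y : Matrix ι ι ℝ} (hY : Y ∈ hodgeIsotropyLie Φ) :
    ((X * Y - Y * X) * jMatrix Φ).trace = 0 :=
  trace_sub_mul_eq_zero_of_comm hY.2.symm

/-- **`dim 𝔨 ≤ 3 ⟹ 𝔨` IS COMMUTATIVE** (polarised complex torus, any dimension).  `𝔨 ∋ J` has `J` in its centre and
carries the negative definite invariant trace form; for `X, Y ∈ 𝔨` the commutator `C = [X, Y] ∈ 𝔨` is trace-orthogonal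
to `J`, `X` and `Y`, so if `J, X, Y` span `𝔨` then `tr(C²) = 0` and `C = 0`, while if they are linearly dependent `X`
and `Y` commute outright.  (A real Lie algebra of dimension `≤ 3` with nonzero centre and a definite invariant form is
abelian.) [cite: MoonenZarhin1999LowDim, §2 (2.2) and Prop. (2.4) (2)] [cite: FiteEtAl2012, §3.2 Lemma 3.7]
[cite: Mostow1974StrongRigidity, §2.10 (p. 16)] -/
theorem IsRiemannForm.comm_of_mem_hodgeIsotropyLie_of_finrank_le_three (hη : IsRiemannForm Φ η)
    (h3 : finrank ℝ (hodgeIsotropyLie Φ) ≤ 3) {X Y : Matrix ι ι ℝ} (hX : X ∈ hodgeIsotropyLie Φ)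
    (hY : Y ∈ hodgeIsotropyLie Φ) : X * Y = Y * X := by
  letI : LieRing (Matrix ι ι ℝ) := LieRing.ofAssociativeRing
  have hCmem : X * Y - Y * X ∈ hodgeIsotropyLie Φ := by
    have h := (hodgeIsotropyLie Φ).lie_mem hX hY
    rwa [Ring.lie_def] at h
  have hCJ : ((X * Y - Y * X) * jMatrix Φ).trace = 0 := trace_sub_mul_jMatrix_eq_zero hY
  have hCX := trace_sub_mul_left_eq_zero X Y
  have hCY := trace_sub_mul_right_eq_zero X Y
  by_cases hli : LinearIndependent ℝ ![jMatrix Φ, X, Y]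
  · -- `𝔨 = span{J, X, Y}`: the commutator is a combination of `J, X, Y`, hence `tr(C²) = 0`
    have hle : Submodule.span ℝ (Set.range ![jMatrix Φ, X, Y]) ≤ (hodgeIsotropyLie Φ).toSubmodule := by
      rw [Submodule.span_le]
      rintro _ ⟨i, rfl⟩
      fin_cases i
      · exact jMatrix_mem_hodgeIsotropyLie Φ
      · exact hX
      · exact hY
    have hspan : finrank ℝ (Submodule.span ℝ (Set.range ![jMatrix Φ, X, Y])) = 3 := by
      rw [finrank_span_eq_card hli, Fintype.card_fin]
    have heq : Submodule.span ℝ (Set.range ![jMatrix Φ, X, Y]) = (hodgeIsotropyLie Φ).toSubmodule :=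
      Submodule.eq_of_le_of_finrank_le hle (by
        change finrank ℝ (hodgeIsotropyLie Φ) ≤ _
        rw [hspan]
        exact h3)
    have hC : X * Y - Y * X ∈ Submodule.span ℝ (Set.range ![jMatrix Φ, X, Y]) := by
      rw [heq]
      exact hCmem
    obtain ⟨c, hc⟩ := (Submodule.mem_span_range_iff_exists_fun ℝ).1 hC
    have htr : ((X * Y - Y * X) * (X * Y - Y * X)).trace = 0 := by
      nth_rewrite 2 [← hc]
      rw [Fin.sum_univ_three]
      simp only [Matrix.cons_val_zero, Matrix.cons_val_one, Matrix.cons_val_two, Matrix.head_cons, Matrix.tail_cons,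
        Matrix.mul_add, Matrix.mul_smul, Matrix.trace_add, Matrix.trace_smul, hCJ, hCX, hCY, smul_zero, add_zero]
    by_contra hne
    exact (hη.trace_mul_self_neg_of_mem_hodgeIsotropyLie hCmem (fun h ↦ hne (sub_eq_zero.1 h))).ne htr
  · -- `J, X, Y` linearly dependent: `X` and `Y` commute outright
    obtain ⟨g, hg, i, hi⟩ := Fintype.not_linearIndependent_iff.1 hli
    rw [Fin.sum_univ_three] at hg
    simp only [Matrix.cons_val_zero, Matrix.cons_val_one, Matrix.cons_val_two, Matrix.head_cons,
      Matrix.tail_cons] at hg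
    -- `hg : g 0 • J + g 1 • X + g 2 • Y = 0`
    by_cases h2 : g 2 = 0
    · by_cases h1 : g 1 = 0
      · -- then `g 0 ≠ 0` and `J = 0`, so `-1 = J² = 0` and every matrix vanishes
        have h0 : g 0 ≠ 0 := by
          fin_cases i
          · exact hi
          · exact absurd h1 hi
          · exact absurd h2 hi
        rw [h1, h2, zero_smul, zero_smul, add_zero, add_zero] at hg
        have hJ0 : jMatrix Φ = 0 := (smul_eq_zero.1 hg).resolve_left h0
        have h10 : (1 : Matrix ι ι ℝ) = 0 := by
          have hJJ := jMatrix_mul_jMatrix Φ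
          rw [hJ0, Matrix.mul_zero] at hJJ
          exact neg_eq_zero.1 hJJ.symm
        have hX0 : X = 0 := by rw [← Matrix.mul_one X, h10, Matrix.mul_zero]
        rw [hX0, Matrix.zero_mul, Matrix.mul_zero]
      · -- `g 1 ≠ 0`, `g 2 = 0`: `X ∈ ℝJ` commutes with `Y ∈ 𝔨`
        rw [h2, zero_smul, add_zero] at hg
        have e : g 1 • X = -(g 0 • jMatrix Φ) := by
          rw [eq_neg_iff_add_eq_zero, add_comm]
          exact hg
        have key : g 1 • (X * Y) = g 1 • (Y * X) := by
          rw [← Matrix.smul_mul, ← Matrix.mul_smul, e, Matrix.neg_mul, Matrix.mul_neg, Matrix.smul_mul,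
            Matrix.mul_smul, hY.2]
        exact smul_right_injective _ h1 key
    · -- `g 2 ≠ 0`: `Y ∈ span{J, X}` commutes with `X`
      have e : g 2 • Y = -(g 0 • jMatrix Φ + g 1 • X) := by
        rw [eq_neg_iff_add_eq_zero, add_comm]
        exact hg
      have key : g 2 • (X * Y) = g 2 • (Y * X) := by
        rw [← Matrix.mul_smul, ← Matrix.smul_mul, e, Matrix.mul_neg, Matrix.neg_mul, Matrix.mul_add,
          Matrix.add_mul, Matrix.mul_smul, Matrix.mul_smul, Matrix.smul_mul, Matrix.smul_mul, hX.2]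
      exact smul_right_injective _ h2 key

/-- **`dim 𝔨 ≤ 3 ⟹ dim 𝔨 ≤ g`**: a commutative isotropy algebra is a commutative subalgebra of `𝔲(V, E, J) ≅ 𝔲(g)`,
of dimension at most `g` (a maximal torus of `U(g)`; the tree's `IsRiemannForm.finrank_le_of_le_hodgeIsotropyLie_of_forall_comm`).
So `dim 𝔨` never lies strictly between `g` and `4`. [cite: MoonenZarhin1999LowDim, §2 (2.2) and Prop. (2.4) (2)]
[cite: BrockerTomDieck1985, IV (3.1) (p. 157)] [cite: FiteEtAl2012, §3.2 Lemma 3.7] -/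
theorem IsRiemannForm.finrank_hodgeIsotropyLie_le_of_finrank_le_three [FiniteDimensional ℂ E]
    (hη : IsRiemannForm Φ η) (h3 : finrank ℝ (hodgeIsotropyLie Φ) ≤ 3) :
    finrank ℝ (hodgeIsotropyLie Φ) ≤ finrank ℂ E := by
  letI : LieRing (Matrix ι ι ℝ) := LieRing.ofAssociativeRing
  change finrank ℝ (hodgeIsotropyLie Φ).toSubmodule ≤ _
  exact hη.finrank_le_of_le_hodgeIsotropyLie_of_forall_comm (𝔞 := (hodgeIsotropyLie Φ).toSubmodule)
    (fun _ hX ↦ hX) (fun X hX Y hY ↦ hη.comm_of_mem_hodgeIsotropyLie_of_finrank_le_three h3 hX hY)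

/-- **`dim 𝔨 ≤ g` or `dim 𝔨 ≥ 4`** for every polarised complex torus of dimension `g`.
[cite: MoonenZarhin1999LowDim, §2 (2.2) and Prop. (2.4)] [cite: FiteEtAl2012, §3.2 Lemma 3.7] -/
theorem IsRiemannForm.finrank_hodgeIsotropyLie_le_or_four_le [FiniteDimensional ℂ E] (hη : IsRiemannForm Φ η) :
    finrank ℝ (hodgeIsotropyLie Φ) ≤ finrank ℂ E ∨ 4 ≤ finrank ℝ (hodgeIsotropyLie Φ) := by
  by_cases h3 : finrank ℝ (hodgeIsotropyLie Φ) ≤ 3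
  · exact Or.inl (hη.finrank_hodgeIsotropyLie_le_of_finrank_le_three h3)
  · exact Or.inr (by omega)

/-- **A non-commutative isotropy algebra has dimension `≥ 4`** (polarised torus).
[cite: MoonenZarhin1999LowDim, §2 Prop. (2.4)] [cite: FiteEtAl2012, §3.2 Lemma 3.7] -/
theorem IsRiemannForm.four_le_finrank_hodgeIsotropyLie_of_ne (hη : IsRiemannForm Φ η) {X Y : Matrix ι ι ℝ}
    (hX : X ∈ hodgeIsotropyLie Φ) (hY : Y ∈ hodgeIsotropyLie Φ) (hXY : X * Y ≠ Y * X) :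
    4 ≤ finrank ℝ (hodgeIsotropyLie Φ) := by
  by_contra h
  exact hXY (hη.comm_of_mem_hodgeIsotropyLie_of_finrank_le_three (by omega) hX hY)

/-- **JACOBI: `[𝔭, 𝔭] ⊆ ℝJ ⟹ dim_ℝ 𝔭 ≤ 2`** (polarised torus).  If every bracket of two elements of `𝔭` is a real
multiple of `J`, write `[P, Q] = ω(P, Q) J`; since `[J, R] = 2JR` on `𝔭`, the Jacobi identity for `P, Q, R ∈ 𝔭` reads
`J(ω(P,Q) R + ω(Q,R) P + ω(R,P) Q) = 0`.  If `dim 𝔭 ≥ 3`, choose `P ≠ 0`, `Q = JP` and `R ∉ span{P, JP}`: then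
`ω(P, JP) = 0`, contradicting `[P, JP] = -2JP² ≠ 0` (§1).  So `𝔭` is at most one complex line — the isotropy `ℝJ` of an
elliptic curve only supports `𝔥𝔤_ℝ ⊆ 𝔰𝔩₂(ℝ)`-sized algebras ("`Hg(X) = Sp(V, φ) ≅ SL_{2,ℚ}`" / "`Hg(X) = U_F`").
[cite: MoonenZarhin1999LowDim, §2 (2.1)] [cite: Imai1976HodgeGroups, §2 (p. 368)] [cite: FiteEtAl2012, §3.2 Lemma 3.7] -/
theorem IsRiemannForm.finrank_hodgeCartanP_le_two_of_forall_sub_mem_span (hη : IsRiemannForm Φ η)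
    (h : ∀ P ∈ hodgeCartanP Φ, ∀ Q ∈ hodgeCartanP Φ, P * Q - Q * P ∈ ℝ ∙ jMatrix Φ) :
    finrank ℝ (hodgeCartanP Φ) ≤ 2 := by
  by_contra hlt
  push Not at hlt
  have hne : hodgeCartanP Φ ≠ ⊥ := by
    intro hbot
    rw [hbot, finrank_bot] at hlt
    exact absurd hlt (by norm_num)
  obtain ⟨P, hP, hP0⟩ := (Submodule.ne_bot_iff _).1 hne
  have hQ : jMatrix Φ * P ∈ hodgeCartanP Φ := jMatrix_mul_mem_hodgeCartanP Φ hP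
  -- some `R ∈ 𝔭` outside the plane `span{P, JP}`
  obtain ⟨R, hR, hRout⟩ : ∃ R ∈ hodgeCartanP Φ, R ∉ Submodule.span ℝ (Set.range ![P, jMatrix Φ * P]) := by
    by_contra hall
    push Not at hall
    have hle : hodgeCartanP Φ ≤ Submodule.span ℝ (Set.range ![P, jMatrix Φ * P]) := fun R hR ↦ hall R hR
    have h2 : finrank ℝ (Submodule.span ℝ (Set.range ![P, jMatrix Φ * P])) ≤ 2 := by
      have h' := finrank_range_le_card (R := ℝ) ![P, jMatrix Φ * P]
      rwa [Fintype.card_fin] at h'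
    exact absurd ((Submodule.finrank_mono hle).trans h2) (not_le.2 hlt)
  -- the three structure constants
  obtain ⟨a, ha⟩ := Submodule.mem_span_singleton.1 (h P hP _ hQ)
  obtain ⟨b, hb⟩ := Submodule.mem_span_singleton.1 (h _ hQ R hR)
  obtain ⟨c, hc⟩ := Submodule.mem_span_singleton.1 (h R hR P hP)
  -- the Jacobi identity for `P, JP, R`
  have jacobi : (P * (jMatrix Φ * P) - jMatrix Φ * P * P) * R - R * (P * (jMatrix Φ * P) - jMatrix Φ * P * P)
      + ((jMatrix Φ * P * R - R * (jMatrix Φ * P)) * P - P * (jMatrix Φ * P * R - R * (jMatrix Φ * P)))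
      + ((R * P - P * R) * (jMatrix Φ * P) - jMatrix Φ * P * (R * P - P * R)) = 0 := by
    noncomm_ring
  rw [← ha, ← hb, ← hc, Matrix.smul_mul, Matrix.mul_smul, ← smul_sub, Matrix.smul_mul, Matrix.mul_smul, ← smul_sub,
    Matrix.smul_mul, Matrix.mul_smul, ← smul_sub, jMatrix_mul_sub_mul_jMatrix_eq_two_smul hR,
    jMatrix_mul_sub_mul_jMatrix_eq_two_smul hP, jMatrix_mul_sub_mul_jMatrix_eq_two_smul hQ, smul_smul, smul_smul,
    smul_smul, ← Matrix.mul_smul, ← Matrix.mul_smul, ← Matrix.mul_smul, ← Matrix.mul_add, ← Matrix.mul_add] at jacobi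
  -- `jacobi : J ((2a) R + (2b) P + (2c) JP) = 0`, hence the bracket vanishes
  have hsum : (a * 2) • R + (b * 2) • P + (c * 2) • (jMatrix Φ * P) = 0 := by
    have h' := congrArg (jMatrix Φ * ·) jacobi
    simp only [jMatrix_mul_jMatrix_mul, Matrix.mul_zero, neg_eq_zero] at h'
    exact h'
  -- `a = 0`, for otherwise `R ∈ span{P, JP}`
  have ha0 : a = 0 := by
    by_contra ha0
    apply hRout
    have h2a : a * 2 ≠ 0 := mul_ne_zero ha0 two_ne_zero
    rw [← Submodule.smul_mem_iff _ h2a]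
    have e : (a * 2) • R = -((b * 2) • P + (c * 2) • (jMatrix Φ * P)) := by
      rw [eq_neg_iff_add_eq_zero, ← add_assoc]
      exact hsum
    rw [e]
    refine Submodule.neg_mem _ (Submodule.add_mem _ (Submodule.smul_mem _ _ ?_) (Submodule.smul_mem _ _ ?_))
    · exact Submodule.subset_span ⟨0, rfl⟩
    · exact Submodule.subset_span ⟨1, rfl⟩
  -- but then `[P, JP] = 0`, contradicting `P ≠ 0`
  rw [ha0, zero_smul] at ha
  exact hη.mul_jMatrix_mul_sub_ne_zero hP hP0 ha.symm

variable (Φ) in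
/-- **`dim 𝔨 = 1 ⟹ 𝔨 = ℝJ`** (every complex torus with `ι ≠ ∅`; `0 ≠ J ∈ 𝔨`).
[cite: MoonenZarhin1999LowDim, §2 (2.1)] [cite: Imai1976HodgeGroups, §2 (p. 368)] -/
theorem exists_smul_jMatrix_eq_of_finrank_hodgeIsotropyLie_eq_one [Nonempty ι]
    (h1 : finrank ℝ (hodgeIsotropyLie Φ) = 1) {X : Matrix ι ι ℝ} (hX : X ∈ hodgeIsotropyLie Φ) :
    ∃ c : ℝ, c • jMatrix Φ = X := by
  letI : LieRing (Matrix ι ι ℝ) := LieRing.ofAssociativeRing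
  have hle : (ℝ ∙ jMatrix Φ) ≤ (hodgeIsotropyLie Φ).toSubmodule :=
    (Submodule.span_singleton_le_iff_mem _ _).2 (jMatrix_mem_hodgeIsotropyLie Φ)
  have heq : (ℝ ∙ jMatrix Φ) = (hodgeIsotropyLie Φ).toSubmodule :=
    Submodule.eq_of_le_of_finrank_le hle (by
      change finrank ℝ (hodgeIsotropyLie Φ) ≤ _
      rw [h1, finrank_span_singleton (jMatrix_ne_zero Φ)])
  have hX' : X ∈ (ℝ ∙ jMatrix Φ) := by
    rw [heq]
    exact hX
  exact Submodule.mem_span_singleton.1 hX'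

/-- **`dim 𝔨 = 1 ⟹ dim 𝔭 ≤ 2`** (polarised torus, any `g`): `[𝔭, 𝔭] ⊆ 𝔨 = ℝJ` and the Jacobi lemma.
[cite: MoonenZarhin1999LowDim, §2 (2.1)] [cite: Imai1976HodgeGroups, §2 (p. 368)] [cite: FiteEtAl2012, §3.2 Lemma 3.7] -/
theorem IsRiemannForm.finrank_hodgeCartanP_le_two_of_finrank_hodgeIsotropyLie_eq_one [Nonempty ι]
    (hη : IsRiemannForm Φ η) (h1 : finrank ℝ (hodgeIsotropyLie Φ) = 1) : finrank ℝ (hodgeCartanP Φ) ≤ 2 := by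
  letI : LieRing (Matrix ι ι ℝ) := LieRing.ofAssociativeRing
  refine hη.finrank_hodgeCartanP_le_two_of_forall_sub_mem_span fun P hP Q hQ ↦ ?_
  have hmem : P * Q - Q * P ∈ hodgeIsotropyLie Φ := by
    have h := lie_mem_hodgeIsotropyLie hP hQ
    rwa [Ring.lie_def] at h
  obtain ⟨c, hc⟩ := exists_smul_jMatrix_eq_of_finrank_hodgeIsotropyLie_eq_one Φ h1 hmem
  exact Submodule.mem_span_singleton.2 ⟨c, hc⟩

/-- **`dim 𝔨 = 1 ⟹ dim 𝔭 ∈ {0, 2}`** (`dim 𝔭` is even). [cite: MoonenZarhin1999LowDim, §2 (2.1)] [cite: Imai1976HodgeGroups, §2 (p. 368)] -/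
theorem IsRiemannForm.finrank_hodgeCartanP_eq_zero_or_eq_two_of_finrank_hodgeIsotropyLie_eq_one [Nonempty ι]
    (hη : IsRiemannForm Φ η) (h1 : finrank ℝ (hodgeIsotropyLie Φ) = 1) :
    finrank ℝ (hodgeCartanP Φ) = 0 ∨ finrank ℝ (hodgeCartanP Φ) = 2 := by
  have h2 := hη.finrank_hodgeCartanP_le_two_of_finrank_hodgeIsotropyLie_eq_one h1
  obtain ⟨m, hm⟩ := even_finrank_hodgeCartanP Φ
  omega

/-- **`dim 𝔨 = 1 ⟹ dim 𝔥𝔤_ℝ ∈ {1, 3}`**: an isotropy algebra reduced to `ℝJ` only occurs for `𝔥𝔤_ℝ = ℝJ` (CM, `𝔭 = 0`)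
or `𝔥𝔤_ℝ = ℝJ ⊕ ℝP ⊕ ℝJP ≅ 𝔰𝔩₂(ℝ)` — in every dimension `g` (e.g. powers `Eᵍ` of an elliptic curve, false elliptic
curves). [cite: MoonenZarhin1999LowDim, §2 (2.1)–(2.2)] [cite: Imai1976HodgeGroups, §2 (p. 368)] [cite: FiteEtAl2012, §3.2 Lemma 3.7] -/
theorem IsRiemannForm.finrank_hodgeGroupLie_eq_one_or_eq_three_of_finrank_hodgeIsotropyLie_eq_one [Nonempty ι]
    (hη : IsRiemannForm Φ η) (h1 : finrank ℝ (hodgeIsotropyLie Φ) = 1) :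
    finrank ℝ (hodgeGroupLie Φ) = 1 ∨ finrank ℝ (hodgeGroupLie Φ) = 3 := by
  have h := finrank_hodgeGroupLie_eq_finrank_hodgeIsotropyLie_add_finrank_hodgeCartanP Φ
  rcases hη.finrank_hodgeCartanP_eq_zero_or_eq_two_of_finrank_hodgeIsotropyLie_eq_one h1 with h0 | h2 <;> omega

/-- **`dim 𝔨 = 1 ⟹ dim 𝔥𝔤_ℝ ≤ 3`**. [cite: MoonenZarhin1999LowDim, §2 (2.1)] [cite: Imai1976HodgeGroups, §2 (p. 368)] -/
theorem IsRiemannForm.finrank_hodgeGroupLie_le_three_of_finrank_hodgeIsotropyLie_eq_one [Nonempty ι]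
    (hη : IsRiemannForm Φ η) (h1 : finrank ℝ (hodgeIsotropyLie Φ) = 1) : finrank ℝ (hodgeGroupLie Φ) ≤ 3 := by
  rcases hη.finrank_hodgeGroupLie_eq_one_or_eq_three_of_finrank_hodgeIsotropyLie_eq_one h1 with h | h <;> omega

variable (Φ) in
/-- **`dim 𝔨 = 1 ⟹ P²` IS SCALAR for every `P ∈ 𝔭`** (every complex torus with `ι ≠ ∅`): `[P, JP] = -2JP² ∈ 𝔨 = ℝJ`
forces `P² ∈ ℝ·1` — as for `𝔥𝔤_ℝ(E^g) = Δ 𝔰𝔩₂(ℝ)`. [cite: MoonenZarhin1999LowDim, §1 and §2 (2.1)] [cite: Imai1976HodgeGroups, §2 (p. 368)] -/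
theorem exists_mul_self_eq_smul_one_of_finrank_hodgeIsotropyLie_eq_one [Nonempty ι]
    (h1 : finrank ℝ (hodgeIsotropyLie Φ) = 1) {P : Matrix ι ι ℝ} (hP : P ∈ hodgeCartanP Φ) :
    ∃ β : ℝ, P * P = β • (1 : Matrix ι ι ℝ) := by
  letI : LieRing (Matrix ι ι ℝ) := LieRing.ofAssociativeRing
  have hmem : P * (jMatrix Φ * P) - jMatrix Φ * P * P ∈ hodgeIsotropyLie Φ := by
    have h := lie_mem_hodgeIsotropyLie hP (jMatrix_mul_mem_hodgeCartanP Φ hP)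
    rwa [Ring.lie_def] at h
  obtain ⟨c, hc⟩ := exists_smul_jMatrix_eq_of_finrank_hodgeIsotropyLie_eq_one Φ h1 hmem
  rw [mul_jMatrix_mul_sub_eq_neg_two_smul hP] at hc
  -- `hc : c • J = -2 • J P²`; multiply by `J`
  have h' := congrArg (jMatrix Φ * ·) hc
  simp only [Matrix.mul_smul, jMatrix_mul_jMatrix, jMatrix_mul_jMatrix_mul, smul_neg, neg_inj] at h'
  -- `h' : c • 1 = -2 • (P * P)`
  refine ⟨(-2 : ℝ)⁻¹ * c, ?_⟩
  calc P * P = (-2 : ℝ)⁻¹ • ((-(2 : ℝ)) • (P * P)) := by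
        rw [smul_smul, inv_mul_cancel₀ (by norm_num : (-2 : ℝ) ≠ 0), one_smul]
    _ = ((-2 : ℝ)⁻¹ * c) • 1 := by rw [← h', smul_smul]

/-- With a polarisation the scalar is positive for `P ≠ 0`: `P² = β·1`, `β = tr(P²)/2g > 0`.
[cite: MoonenZarhin1999LowDim, §2 (2.1)] [cite: Mostow1974StrongRigidity, §2.10 (p. 16)] -/
theorem IsRiemannForm.exists_pos_mul_self_eq_smul_one_of_finrank_hodgeIsotropyLie_eq_one [Nonempty ι]
    (hη : IsRiemannForm Φ η) (h1 : finrank ℝ (hodgeIsotropyLie Φ) = 1) {P : Matrix ι ι ℝ}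
    (hP : P ∈ hodgeCartanP Φ) (h0 : P ≠ 0) : ∃ β : ℝ, 0 < β ∧ P * P = β • (1 : Matrix ι ι ℝ) := by
  obtain ⟨β, hβ⟩ := exists_mul_self_eq_smul_one_of_finrank_hodgeIsotropyLie_eq_one Φ h1 hP
  refine ⟨β, ?_, hβ⟩
  have hpos := hη.trace_mul_self_pos_of_mem_hodgeCartanP hP h0
  rw [hβ, Matrix.trace_smul, Matrix.trace_one, smul_eq_mul] at hpos
  exact pos_of_mul_pos_left hpos (Nat.cast_nonneg _)

end SmallIsotropy

/-! ## §3 Dimension `g = 1` and `g = 2`: the dimension tables -/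

section Tables

variable {ι : Type*} [Fintype ι] [DecidableEq ι] {E : Type*} [NormedAddCommGroup E] [NormedSpace ℂ E]
  {Φ : (ι → ℝ) ≃L[ℝ] E} {η : E [⋀^Fin 2]→L[ℝ] ℝ}

omit [DecidableEq ι] in
/-- `ι ≠ ∅` as soon as `dim_ℂ V > 0` (`|ι| = 2g`). [cite: Lange2023AbelianVarietiesComplex, §1.1.1] -/
private theorem nonempty_of_finrank_pos [FiniteDimensional ℂ E] (Φ : (ι → ℝ) ≃L[ℝ] E) (h : 0 < finrank ℂ E) :
    Nonempty ι :=
  Fintype.card_pos_iff.1 (by rw [card_eq_two_mul_finrank Φ]; omega)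

/-! ### `g = 1`: `(dim 𝔨, dim 𝔭) ∈ {(1, 0), (1, 2)}` -/

/-- **`g = 1 ⟹ dim 𝔨 = 1`** (`1 ≤ dim 𝔨 ≤ g² = 1`): the isotropy algebra of a polarised complex torus of dimension one
is `ℝJ`. [cite: MoonenZarhin1999LowDim, §2 (2.1)] [cite: Imai1976HodgeGroups, §2 (p. 368)] -/
theorem IsRiemannForm.finrank_hodgeIsotropyLie_eq_one_of_finrank_eq_one [FiniteDimensional ℂ E]
    (hη : IsRiemannForm Φ η) (hg : finrank ℂ E = 1) : finrank ℝ (hodgeIsotropyLie Φ) = 1 := by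
  haveI := nonempty_of_finrank_pos Φ (by omega)
  have h1 := hη.finrank_hodgeIsotropyLie_le_sq
  rw [hg, one_pow] at h1
  have h2 := finrank_hodgeIsotropyLie_pos Φ
  omega

/-- **`g = 1 ⟹ (dim 𝔨, dim 𝔭) ∈ {(1, 0), (1, 2)}`**: the two cases "`Hg(X) = U_F`" (CM: `𝔥𝔤_ℝ = ℝJ`) and
"`Hg(X) = SL₂`" (`𝔥𝔤_ℝ = 𝔰𝔩₂(ℝ) = ℝJ ⊕ 𝔭`, `dim 𝔭 = 2`) at the level of real dimensions, for every polarised complex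
torus of dimension one. [cite: MoonenZarhin1999LowDim, §2 (2.1)] [cite: Imai1976HodgeGroups, §2 (p. 368)] -/
theorem IsRiemannForm.finrank_prod_mem_of_finrank_eq_one [FiniteDimensional ℂ E] (hη : IsRiemannForm Φ η)
    (hg : finrank ℂ E = 1) :
    (finrank ℝ (hodgeIsotropyLie Φ), finrank ℝ (hodgeCartanP Φ)) ∈ ({(1, 0), (1, 2)} : Finset (ℕ × ℕ)) := by
  haveI := nonempty_of_finrank_pos Φ (by omega)
  have h1 := hη.finrank_hodgeIsotropyLie_eq_one_of_finrank_eq_one hg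
  simp only [Finset.mem_insert, Finset.mem_singleton, Prod.mk.injEq]
  rcases hη.finrank_hodgeCartanP_eq_zero_or_eq_two_of_finrank_hodgeIsotropyLie_eq_one h1 with h | h <;> omega

/-- **`g = 1 ⟹ dim 𝔥𝔤_ℝ ∈ {1, 3}`** for every polarised complex torus of dimension one ("`Hg(E)` is a 1-dimensional
torus if `E` is of CM-type, … `Hg(E) = SL₂` if not"). [cite: Imai1976HodgeGroups, §2 (p. 368)] [cite: MoonenZarhin1999LowDim, §2 (2.1)] -/
theorem IsRiemannForm.finrank_hodgeGroupLie_mem_of_finrank_eq_one [FiniteDimensional ℂ E] (hη : IsRiemannForm Φ η)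
    (hg : finrank ℂ E = 1) : finrank ℝ (hodgeGroupLie Φ) ∈ ({1, 3} : Finset ℕ) := by
  have h := hη.finrank_prod_mem_of_finrank_eq_one hg
  have hsum := finrank_hodgeGroupLie_eq_finrank_hodgeIsotropyLie_add_finrank_hodgeCartanP Φ
  simp only [Finset.mem_insert, Finset.mem_singleton, Prod.mk.injEq] at h ⊢
  omega

/-! ### `g = 2`: abelian surfaces -/

/-- **`g = 2 ⟹ dim 𝔨 ≤ 2` or `dim 𝔨 = 4`** (`dim 𝔨 ≤ g` or `4 ≤ dim 𝔨 ≤ g² = 4`).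
[cite: MoonenZarhin1999LowDim, §2 (2.2) and Prop. (2.4)] [cite: FiteEtAl2012, §3.2 Lemma 3.7] -/
theorem IsRiemannForm.finrank_hodgeIsotropyLie_le_two_or_eq_four_of_finrank_eq_two [FiniteDimensional ℂ E]
    (hη : IsRiemannForm Φ η) (hg : finrank ℂ E = 2) :
    finrank ℝ (hodgeIsotropyLie Φ) ≤ 2 ∨ finrank ℝ (hodgeIsotropyLie Φ) = 4 := by
  have hsq := hη.finrank_hodgeIsotropyLie_le_sq
  rw [hg] at hsq
  rcases hη.finrank_hodgeIsotropyLie_le_or_four_le with h | h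
  · exact Or.inl (by rwa [hg] at h)
  · exact Or.inr (by norm_num at hsq; omega)

/-- **`g = 2 ⟹ dim 𝔨 ∈ {1, 2, 4}`**: the isotropy algebra `𝔨 ⊆ 𝔲(V, E, J) ≅ 𝔲(2)` of an abelian surface is `ℝJ`, a
`2`-torus, or all of `𝔲(2)` — the maximal compact `𝔲(1)`, `𝔲(1)`, `𝔲(1)²`, `𝔲(1)²`, `𝔲(1)²`, `𝔲(2)` of
`𝔲(1), 𝔰𝔩₂(ℝ), 𝔲(1)², 𝔲(1) ⊕ 𝔰𝔩₂(ℝ), 𝔰𝔩₂(ℝ)², 𝔰𝔭₄(ℝ)`; never of dimension `3`.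
[cite: MoonenZarhin1999LowDim, §2 (2.2) and Prop. (2.4)] [cite: FiteEtAl2012, §3.2 Lemma 3.7] -/
theorem IsRiemannForm.finrank_hodgeIsotropyLie_mem_of_finrank_eq_two [FiniteDimensional ℂ E]
    (hη : IsRiemannForm Φ η) (hg : finrank ℂ E = 2) :
    finrank ℝ (hodgeIsotropyLie Φ) ∈ ({1, 2, 4} : Finset ℕ) := by
  haveI := nonempty_of_finrank_pos Φ (by omega)
  have hpos := finrank_hodgeIsotropyLie_pos Φ
  have h := hη.finrank_hodgeIsotropyLie_le_two_or_eq_four_of_finrank_eq_two hg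
  simp only [Finset.mem_insert, Finset.mem_singleton]
  omega

/-- **`g = 2 ⟹ dim 𝔨 ≠ 3`**. [cite: MoonenZarhin1999LowDim, §2 (2.2) and Prop. (2.4)] [cite: FiteEtAl2012, §3.2 Lemma 3.7] -/
theorem IsRiemannForm.finrank_hodgeIsotropyLie_ne_three_of_finrank_eq_two [FiniteDimensional ℂ E]
    (hη : IsRiemannForm Φ η) (hg : finrank ℂ E = 2) : finrank ℝ (hodgeIsotropyLie Φ) ≠ 3 := by
  rcases hη.finrank_hodgeIsotropyLie_le_two_or_eq_four_of_finrank_eq_two hg with h | h <;> omega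

/-- **`g = 2 ⟹ dim 𝔭 ∈ {0, 2, 4, 6}`** (`dim 𝔭 ≤ g(g+1) = 6` is even: `𝔭 = T_J D` is a complex subspace of
`T_J 𝔥₂ ≅ Sym₂(ℂ)`). [cite: Lange2023AbelianVarietiesComplex, §7.3.1 Prop. 7.3.2 (pp. 337–338) and §7.1.2 (p. 330)]
[cite: MoonenZarhin1999LowDim, §2 (2.2)] -/
theorem IsRiemannForm.finrank_hodgeCartanP_mem_of_finrank_eq_two [FiniteDimensional ℂ E] (hη : IsRiemannForm Φ η)
    (hg : finrank ℂ E = 2) : finrank ℝ (hodgeCartanP Φ) ∈ ({0, 2, 4, 6} : Finset ℕ) := by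
  have h6 := hη.finrank_hodgeCartanP_le_mul_succ
  rw [hg] at h6
  obtain ⟨m, hm⟩ := even_finrank_hodgeCartanP Φ
  simp only [Finset.mem_insert, Finset.mem_singleton]
  omega

/-- **`g = 2`, `dim 𝔨 = 4 ⟹ 𝔭 ≠ 0`**: an isotropy algebra filling `𝔲(V, E, J) ≅ 𝔲(2)` is non-commutative, while
`𝔭 = 0` would make `𝔥𝔤_ℝ = 𝔨` commutative of dimension `≤ g = 2` (g18-#2, g19-#2).
[cite: MoonenZarhin1999LowDim, §2 Prop. (2.4) (2)] [cite: Lange2023AbelianVarietiesComplex, §7.2.3 Prop. 7.2.6] -/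
theorem IsRiemannForm.hodgeCartanP_ne_bot_of_finrank_hodgeIsotropyLie_eq_four [FiniteDimensional ℂ E]
    (hη : IsRiemannForm Φ η) (hg : finrank ℂ E = 2) (h4 : finrank ℝ (hodgeIsotropyLie Φ) = 4) :
    hodgeCartanP Φ ≠ ⊥ := fun hbot ↦ by
  have h1 := hη.finrank_hodgeGroupLie_le_of_hodgeCartanP_eq_bot hbot
  have h2 := finrank_hodgeIsotropyLie_le Φ
  rw [hg] at h1
  omega

/-- **`g = 2`: `dim 𝔭 = 6 ⟺ Hg(X) = Sp(V, E)`, and then `dim 𝔨 = 4`** (g18-#4's `𝔭`-criterion at `g(g+1) = 6`).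
[cite: Lange2023AbelianVarietiesComplex, §7.3.1 Prop. 7.3.2 (pp. 337–338)] [cite: MoonenZarhin1999LowDim, §2 (2.2) (Type I(1))] -/
theorem IsRiemannForm.finrank_hodgeCartanP_eq_six_iff_of_finrank_eq_two [FiniteDimensional ℂ E]
    (hη : IsRiemannForm Φ η) (hg : finrank ℂ E = 2) :
    finrank ℝ (hodgeCartanP Φ) = 6 ↔ hodgeGroup Φ = spGroup Φ η := by
  rw [hη.hodgeGroup_eq_spGroup_iff_finrank_hodgeCartanP_eq, hg]

/-- `g = 2`: `dim 𝔭 = 6 ⟹ dim 𝔨 = 4`. [cite: Lange2023AbelianVarietiesComplex, §7.3.1 Prop. 7.3.2 (pp. 337–338)]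
[cite: MoonenZarhin1999LowDim, §2 (2.2) (Type I(1))] -/
theorem IsRiemannForm.finrank_hodgeIsotropyLie_eq_four_of_finrank_hodgeCartanP_eq_six [FiniteDimensional ℂ E]
    (hη : IsRiemannForm Φ η) (hg : finrank ℂ E = 2) (h6 : finrank ℝ (hodgeCartanP Φ) = 6) :
    finrank ℝ (hodgeIsotropyLie Φ) = 4 := by
  have h := hη.finrank_hodgeIsotropyLie_eq_sq_of_finrank_hodgeCartanP_eq (by rw [hg, h6])
  rw [hg] at h
  exact h

/-- **THE HODGE LIE ALGEBRA OF AN ABELIAN SURFACE, dimension table**: for every polarised complex torus of dimension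
`2`, `(dim_ℝ 𝔨, dim_ℝ 𝔭)` is one of `(1,0), (1,2), (2,0), (2,2), (2,4)` or `dim 𝔨 = 4` with `dim 𝔭 ∈ {2, 4, 6}` — the
real-dimension shadow of Moonen–Zarhin's list `Hg ∈ {U_F (CM), U_D, Res_{F/ℚ} SL₂, Sp₄}` for simple surfaces plus the
products of elliptic curves (`𝔥𝔤_ℝ ∈ {𝔲(1), 𝔰𝔩₂(ℝ), 𝔲(1)², 𝔲(1) ⊕ 𝔰𝔩₂(ℝ), 𝔰𝔩₂(ℝ)², 𝔰𝔭₄(ℝ)}`, i.e. the six connected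
Sato–Tate groups `U(1), SU(2), U(1)², U(1) × SU(2), SU(2)², USp(4)` of Fité–Kedlaya–Rotger–Sutherland's Lemma 3.7),
obtained without any classification from (A) `dim 𝔨 ∈ {1, 2, 4}`, (B) `dim 𝔨 = 1 ⟹ dim 𝔭 ≤ 2`, (C) `dim 𝔭 = 6 ⟹ dim 𝔨 = 4`,
`dim 𝔨 = 4 ⟹ 𝔭 ≠ 0`.  (The two entries `(4,2)`, `(4,4)` are excluded by g19-#1's dichotomy `dim 𝔨 = g² ⟹ dim 𝔭 ∈ {0, g(g+1)}`,
`ComplexTorusHodgeLieAlgebraUnitaryMaximal`, consumed in the sequel file; they are kept here so that this file only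
imports modules whose build is available.) [cite: MoonenZarhin1999LowDim, §2 (2.2) and Prop. (2.4)] [cite: FiteEtAl2012, §3.2 Lemma 3.7] -/
theorem IsRiemannForm.finrank_prod_mem_of_finrank_eq_two [FiniteDimensional ℂ E] (hη : IsRiemannForm Φ η)
    (hg : finrank ℂ E = 2) :
    (finrank ℝ (hodgeIsotropyLie Φ), finrank ℝ (hodgeCartanP Φ)) ∈
      ({(1, 0), (1, 2), (2, 0), (2, 2), (2, 4), (4, 2), (4, 4), (4, 6)} : Finset (ℕ × ℕ)) := by
  haveI := nonempty_of_finrank_pos Φ (by omega)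
  have hkpos := finrank_hodgeIsotropyLie_pos Φ
  have hp := hη.finrank_hodgeCartanP_mem_of_finrank_eq_two hg
  simp only [Finset.mem_insert, Finset.mem_singleton, Prod.mk.injEq] at hp ⊢
  rcases hη.finrank_hodgeIsotropyLie_le_two_or_eq_four_of_finrank_eq_two hg with hk | hk
  · -- `dim 𝔨 ∈ {1, 2}`: then `dim 𝔭 ≠ 6`, and `dim 𝔨 = 1 ⟹ dim 𝔭 ≤ 2`
    have hp6 : finrank ℝ (hodgeCartanP Φ) ≠ 6 := fun h6 ↦ by
      have h := hη.finrank_hodgeIsotropyLie_eq_four_of_finrank_hodgeCartanP_eq_six hg h6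
      omega
    by_cases hk1 : finrank ℝ (hodgeIsotropyLie Φ) = 1
    · have h2 := hη.finrank_hodgeCartanP_le_two_of_finrank_hodgeIsotropyLie_eq_one hk1
      omega
    · omega
  · have h0 : finrank ℝ (hodgeCartanP Φ) ≠ 0 := fun h0 ↦
      hη.hodgeCartanP_ne_bot_of_finrank_hodgeIsotropyLie_eq_four hg hk (Submodule.finrank_eq_zero.1 h0)
    omega

/-- **`dim_ℝ 𝔥𝔤_ℝ ∈ {1, 2, 3, 4, 6, 8, 10}` for every abelian surface** (polarised complex torus of dimension `2`);
the value `8 = 4 + 4` is excluded with `(4,4)` in the sequel, leaving the dimensions `1, 2, 3, 4, 6, 10` of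
`𝔲(1), 𝔲(1)², 𝔰𝔩₂(ℝ), 𝔲(1) ⊕ 𝔰𝔩₂(ℝ), 𝔰𝔩₂(ℝ)², 𝔰𝔭₄(ℝ)`; in particular `dim 𝔥𝔤_ℝ ∉ {5, 7, 9}`.
[cite: MoonenZarhin1999LowDim, §2 (2.2) and Prop. (2.4)] [cite: FiteEtAl2012, §3.2 Lemma 3.7] -/
theorem IsRiemannForm.finrank_hodgeGroupLie_mem_of_finrank_eq_two [FiniteDimensional ℂ E] (hη : IsRiemannForm Φ η)
    (hg : finrank ℂ E = 2) : finrank ℝ (hodgeGroupLie Φ) ∈ ({1, 2, 3, 4, 6, 8, 10} : Finset ℕ) := by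
  have h := hη.finrank_prod_mem_of_finrank_eq_two hg
  have hsum := finrank_hodgeGroupLie_eq_finrank_hodgeIsotropyLie_add_finrank_hodgeCartanP Φ
  simp only [Finset.mem_insert, Finset.mem_singleton, Prod.mk.injEq] at h ⊢
  omega

/-- `dim 𝔥𝔤_ℝ ∉ {5, 7, 9}` and `dim 𝔥𝔤_ℝ ≤ 10` for an abelian surface (no isotropy algebra of dimension `3`).
[cite: MoonenZarhin1999LowDim, §2 (2.2) and Prop. (2.4)] [cite: FiteEtAl2012, §3.2 Lemma 3.7] -/
theorem IsRiemannForm.finrank_hodgeGroupLie_ne_of_finrank_eq_two [FiniteDimensional ℂ E] (hη : IsRiemannForm Φ η)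
    (hg : finrank ℂ E = 2) :
    finrank ℝ (hodgeGroupLie Φ) ≠ 5 ∧ finrank ℝ (hodgeGroupLie Φ) ≠ 7 ∧ finrank ℝ (hodgeGroupLie Φ) ≠ 9 ∧
      finrank ℝ (hodgeGroupLie Φ) ≤ 10 := by
  have h := hη.finrank_hodgeGroupLie_mem_of_finrank_eq_two hg
  simp only [Finset.mem_insert, Finset.mem_singleton] at h
  omega

/-- **`dim 𝔥𝔤_ℝ = 10 ⟺ Hg(X) = Sp(V, E)`** for an abelian surface (`10 = g(2g+1) = dim 𝔰𝔭₄`; g17-#1's criterion).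
[cite: Lange2023AbelianVarietiesComplex, §7.3.1 Prop. 7.3.2 (pp. 337–338)] [cite: MoonenZarhin1999LowDim, §2 (2.2) (Type I(1))] -/
theorem IsRiemannForm.finrank_hodgeGroupLie_eq_ten_iff_of_finrank_eq_two [FiniteDimensional ℂ E] (hη : IsRiemannForm Φ η)
    (hg : finrank ℂ E = 2) : finrank ℝ (hodgeGroupLie Φ) = 10 ↔ hodgeGroup Φ = spGroup Φ η := by
  rw [hη.hodgeGroup_eq_spGroup_iff_finrank_hodgeGroupLie_eq, hg]

/-- **`dim 𝔥𝔤_ℝ ≤ 2 ⟺ 𝔭 = 0`** for an abelian surface (the CM cases `𝔲(1)`, `𝔲(1)²`: "Suppose `X` is of CM-type. Then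
`Hg(X)` is a `g`-dimensional algebraic torus"). [cite: MoonenZarhin1999LowDim, §2 Prop. (2.4) (2) and (2.2) (Type IV(2,1))]
[cite: Lange2023AbelianVarietiesComplex, §7.2.3 Prop. 7.2.6] -/
theorem IsRiemannForm.finrank_hodgeGroupLie_le_two_iff_of_finrank_eq_two [FiniteDimensional ℂ E]
    (hη : IsRiemannForm Φ η) (hg : finrank ℂ E = 2) : finrank ℝ (hodgeGroupLie Φ) ≤ 2 ↔ hodgeCartanP Φ = ⊥ := by
  haveI := nonempty_of_finrank_pos Φ (by omega)
  refine ⟨hodgeCartanP_eq_bot_of_finrank_hodgeGroupLie_le_two Φ, fun h ↦ ?_⟩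
  have h1 := hη.finrank_hodgeGroupLie_le_of_hodgeCartanP_eq_bot h
  rwa [hg] at h1

/-- **`dim 𝔥𝔤_ℝ = 3 ⟺ (dim 𝔨, dim 𝔭) = (1, 2)`** for an abelian surface (the `𝔰𝔩₂(ℝ)` cases: `E × E`, false elliptic
curves). [cite: MoonenZarhin1999LowDim, §2 (2.2) (Type II(1)) and §1] [cite: FiteEtAl2012, §3.2 Lemma 3.7 (`SU(2)`)] -/
theorem IsRiemannForm.finrank_hodgeGroupLie_eq_three_iff_of_finrank_eq_two [FiniteDimensional ℂ E]
    (hη : IsRiemannForm Φ η) (hg : finrank ℂ E = 2) :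
    finrank ℝ (hodgeGroupLie Φ) = 3 ↔ finrank ℝ (hodgeIsotropyLie Φ) = 1 ∧ finrank ℝ (hodgeCartanP Φ) = 2 := by
  have h := hη.finrank_prod_mem_of_finrank_eq_two hg
  have hsum := finrank_hodgeGroupLie_eq_finrank_hodgeIsotropyLie_add_finrank_hodgeCartanP Φ
  simp only [Finset.mem_insert, Finset.mem_singleton, Prod.mk.injEq] at h
  omega

/-- **`dim 𝔥𝔤_ℝ = 4 ⟺ (dim 𝔨, dim 𝔭) = (2, 2)`** for an abelian surface (the `𝔲(1) ⊕ 𝔰𝔩₂(ℝ)` case: `E × E'` with exactly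
one CM factor). [cite: MoonenZarhin1999LowDim, §3] [cite: FiteEtAl2012, §3.2 Lemma 3.7 (`U(1) × SU(2)`)] -/
theorem IsRiemannForm.finrank_hodgeGroupLie_eq_four_iff_of_finrank_eq_two [FiniteDimensional ℂ E]
    (hη : IsRiemannForm Φ η) (hg : finrank ℂ E = 2) :
    finrank ℝ (hodgeGroupLie Φ) = 4 ↔ finrank ℝ (hodgeIsotropyLie Φ) = 2 ∧ finrank ℝ (hodgeCartanP Φ) = 2 := by
  have h := hη.finrank_prod_mem_of_finrank_eq_two hg
  have hsum := finrank_hodgeGroupLie_eq_finrank_hodgeIsotropyLie_add_finrank_hodgeCartanP Φ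
  simp only [Finset.mem_insert, Finset.mem_singleton, Prod.mk.injEq] at h
  omega

/-- `∃`-polarisation form: **every abelian surface has `(dim 𝔨, dim 𝔭) ∈ {(1,0), (1,2), (2,0), (2,2), (2,4)} ∪ {4} × {2,4,6}`**.
[cite: MoonenZarhin1999LowDim, §2 (2.2) and Prop. (2.4)] [cite: FiteEtAl2012, §3.2 Lemma 3.7] -/
theorem IsAbelianVariety.finrank_prod_mem_of_finrank_eq_two [FiniteDimensional ℂ E] (hX : IsAbelianVariety Φ)
    (hg : finrank ℂ E = 2) :
    (finrank ℝ (hodgeIsotropyLie Φ), finrank ℝ (hodgeCartanP Φ)) ∈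
      ({(1, 0), (1, 2), (2, 0), (2, 2), (2, 4), (4, 2), (4, 4), (4, 6)} : Finset (ℕ × ℕ)) := by
  obtain ⟨η, hη⟩ := hX
  exact hη.finrank_prod_mem_of_finrank_eq_two hg

/-- `∃`-polarisation form: **every abelian surface has `dim_ℝ 𝔥𝔤_ℝ ∈ {1, 2, 3, 4, 6, 8, 10}`**.
[cite: MoonenZarhin1999LowDim, §2 (2.2) and Prop. (2.4)] [cite: FiteEtAl2012, §3.2 Lemma 3.7] -/
theorem IsAbelianVariety.finrank_hodgeGroupLie_mem_of_finrank_eq_two [FiniteDimensional ℂ E] (hX : IsAbelianVariety Φ)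
    (hg : finrank ℂ E = 2) : finrank ℝ (hodgeGroupLie Φ) ∈ ({1, 2, 3, 4, 6, 8, 10} : Finset ℕ) := by
  obtain ⟨η, hη⟩ := hX
  exact hη.finrank_hodgeGroupLie_mem_of_finrank_eq_two hg

/-- `∃`-polarisation form of (A): **an abelian variety of dimension `g` has `dim 𝔨 ≤ g` or `dim 𝔨 ≥ 4`**.
[cite: MoonenZarhin1999LowDim, §2 Prop. (2.4)] [cite: BrockerTomDieck1985, IV (3.1) (p. 157)] -/
theorem IsAbelianVariety.finrank_hodgeIsotropyLie_le_or_four_le [FiniteDimensional ℂ E] (hX : IsAbelianVariety Φ) :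
    finrank ℝ (hodgeIsotropyLie Φ) ≤ finrank ℂ E ∨ 4 ≤ finrank ℝ (hodgeIsotropyLie Φ) := by
  obtain ⟨η, hη⟩ := hX
  exact hη.finrank_hodgeIsotropyLie_le_or_four_le

/-- `∃`-polarisation form of (B): **an abelian variety with `dim 𝔨 = 1` has `dim 𝔥𝔤_ℝ ∈ {1, 3}`** (any dimension `g`).
[cite: MoonenZarhin1999LowDim, §1 and §2 (2.1)] [cite: Imai1976HodgeGroups, §2 (p. 368)] -/
theorem IsAbelianVariety.finrank_hodgeGroupLie_eq_one_or_eq_three_of_finrank_hodgeIsotropyLie_eq_one [Nonempty ι]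
    (hX : IsAbelianVariety Φ) (h1 : finrank ℝ (hodgeIsotropyLie Φ) = 1) :
    finrank ℝ (hodgeGroupLie Φ) = 1 ∨ finrank ℝ (hodgeGroupLie Φ) = 3 := by
  obtain ⟨η, hη⟩ := hX
  exact hη.finrank_hodgeGroupLie_eq_one_or_eq_three_of_finrank_hodgeIsotropyLie_eq_one h1

end Tables

/-! ## §4 Examples: the squares `E_i × E_i` (`(1, 0)`) and `E_τ × E_τ`, `τ = i·2^{1/4}` (`(1, 2)`) -/

section Examples

/-- **`dim 𝔥𝔤_ℝ(E_τᴺ) ∈ {1, 3}`** for every elliptic curve and `N ≥ 1` (`Hg(Eᴺ) = Hg(E)` diagonally; `𝔥𝔤_ℝ(E) = ℝJ` or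
`𝔰𝔩₂(ℝ)`). [cite: MoonenZarhin1999LowDim, §1 and §2 (2.1)] [cite: Imai1976HodgeGroups, §2 (p. 368)] -/
theorem finrank_hodgeGroupLie_pow_ellipticPeriod_eq_one_or_eq_three {τ : ℂ} (hτ : τ.im ≠ 0) {N : ℕ} (hN : 0 < N) :
    finrank ℝ (hodgeGroupLie (powPeriod (ellipticPeriod hτ) N)) = 1 ∨
      finrank ℝ (hodgeGroupLie (powPeriod (ellipticPeriod hτ) N)) = 3 := by
  rw [finrank_hodgeGroupLie_pow _ hN]
  by_cases h : ellipticEnd hτ = ⊥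
  · exact Or.inr (finrank_hodgeGroupLie_ellipticPeriod_of_eq_bot hτ h)
  · exact Or.inl (finrank_hodgeGroupLie_ellipticPeriod_of_ne_bot hτ h)

/-- **`E_i × E_i` realises `(dim 𝔨, dim 𝔭) = (1, 0)`, `dim 𝔥𝔤_ℝ = 1`** ("`E₁ × E₁`", `E₁` with complex multiplication:
connected Sato–Tate group `U(1)`). [cite: FiteEtAl2012, §3.2 Lemma 3.7 and §4.2 (type **F**)] [cite: MoonenZarhin1999LowDim, §1 and §2 (2.1)] -/
theorem finrank_prod_pow_two_ellipticPeriod_I :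
    finrank ℝ (hodgeIsotropyLie (powPeriod (ellipticPeriod (τ := I) (by simp)) 2)) = 1 ∧
      finrank ℝ (hodgeCartanP (powPeriod (ellipticPeriod (τ := I) (by simp)) 2)) = 0 ∧
        finrank ℝ (hodgeGroupLie (powPeriod (ellipticPeriod (τ := I) (by simp)) 2)) = 1 := by
  have h1 : finrank ℝ (hodgeGroupLie (powPeriod (ellipticPeriod (τ := I) (by simp)) 2)) = 1 := by
    rw [finrank_hodgeGroupLie_pow _ two_pos, finrank_hodgeGroupLie_ellipticPeriod_I]
  have hsum := finrank_hodgeGroupLie_eq_finrank_hodgeIsotropyLie_add_finrank_hodgeCartanP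
    (powPeriod (ellipticPeriod (τ := I) (by simp)) 2)
  have hpos := finrank_hodgeIsotropyLie_pos (powPeriod (ellipticPeriod (τ := I) (by simp)) 2)
  omega

/-- **`E_τ × E_τ`, `τ = i·2^{1/4}` (no complex multiplication), realises `(dim 𝔨, dim 𝔭) = (1, 2)`, `dim 𝔥𝔤_ℝ = 3`**
("`E₂ × E₂`": connected Sato–Tate group `SU(2)`; `𝔥𝔤_ℝ = Δ𝔰𝔩₂(ℝ)`).
[cite: FiteEtAl2012, §3.2 Lemma 3.7 and §4.2 (type **E**)] [cite: MoonenZarhin1999LowDim, §1 and §2 (2.1)] -/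
theorem finrank_prod_pow_two_ellipticPeriod_I_mul_sqrt_sqrt_two :
    finrank ℝ (hodgeIsotropyLie (powPeriod (ellipticPeriod im_I_mul_sqrt_sqrt_two_ne_zero) 2)) = 1 ∧
      finrank ℝ (hodgeCartanP (powPeriod (ellipticPeriod im_I_mul_sqrt_sqrt_two_ne_zero) 2)) = 2 ∧
        finrank ℝ (hodgeGroupLie (powPeriod (ellipticPeriod im_I_mul_sqrt_sqrt_two_ne_zero) 2)) = 3 := by
  have hpos : 0 < (I * (Real.sqrt (Real.sqrt 2) : ℂ)).im := by
    rw [I_mul_im, ofReal_re]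
    positivity
  have hη : IsRiemannForm (powPeriod (ellipticPeriod im_I_mul_sqrt_sqrt_two_ne_zero) 2)
      (powForm (ellipticForm im_I_mul_sqrt_sqrt_two_ne_zero) 2) :=
    (isRiemannForm_ellipticForm hpos).pow 2
  have h3 : finrank ℝ (hodgeGroupLie (powPeriod (ellipticPeriod im_I_mul_sqrt_sqrt_two_ne_zero) 2)) = 3 := by
    rw [finrank_hodgeGroupLie_pow _ two_pos, finrank_hodgeGroupLie_ellipticPeriod_I_mul_sqrt_sqrt_two]
  have hg : finrank ℂ (Fin 2 → ℂ) = 2 := Module.finrank_fin_fun ℂ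
  have hmem := hη.finrank_prod_mem_of_finrank_eq_two hg
  have hsum := finrank_hodgeGroupLie_eq_finrank_hodgeIsotropyLie_add_finrank_hodgeCartanP
    (powPeriod (ellipticPeriod im_I_mul_sqrt_sqrt_two_ne_zero) 2)
  simp only [Finset.mem_insert, Finset.mem_singleton, Prod.mk.injEq] at hmem
  omega

end Examples

end ComplexTorus

end Literature.Geometry.Kaehler
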